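import Mathlib
import HarnessLib
import Summits.Ventures.LatticeQCDFlow.Scaling.TiltAcceptanceCouplingMonotone
import Summits.Ventures.LatticeQCDFlow.Scaling.IdentityFlowAcceptanceCouplingMonotone

/-!
# LatticeQCDFlow / Scaling — the acceptance of the untrained (identity-flow) exact sampler is
# STRICTLY decreasing in the coupling: every tilt family whose statistic is not a.e. constant,
# every Wilson theory with a non-trivial action (product Haar), the factorised 2-d U(1) model

HONEST FRAMING: exact (Metropolis-corrected) sampling algorithms for lattice gauge theory;
figures of merit are autocorrelation/cost numbers at stated couplings and volumes; no
continuum-physics claim.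

Venture `LatticeQCDFlow` (cell pub-lqcd), topic `Scaling`; FANOUT row 3 (`s0-u1-a`, S0-B
implementation A, GEN-17).  NEW WORK of the cell, not a published result; NO definition is
introduced.  Sequel of `Scaling/TiltAcceptanceCouplingMonotone` (the acceptance
`acc(β) = (∫∫ q(x)q(y)·min(e^{βT x}, e^{βT y}) dν dν)/∫ q e^{βT} dν` of `qν`-proposals against the tilt
`q e^{βT}ν/M(β)` is non-increasing on `[0, ∞)`) and `Scaling/IdentityFlowAcceptanceCouplingMonotone`
(Wilson and U(1) forms), both imported: here the decrease is STRICT.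

* §1 proposal density `q ≥ 0`, measurable `T` with the `q`-exponential moments for `γ ≥ 0`:
  `min_one_exp_mul_lt_of_neg` (the overlap kernel `min(1, e^{βs})` is strictly decreasing in
  `β ≥ 0` for `s < 0`); `integral_mul_min_one_exp_lt` (`Φ_{β′}(t) < Φ_β(t)` for `t ≥ c` whenever
  `ν{T < c, q > 0} > 0`, `0 ≤ β < β′`); **`tiltIMH_meanAccept_strictAntiOn`** — if some level `c` has
  `ν{T < c, q > 0} > 0` and `ν{c ≤ T, q > 0} > 0` (i.e. `T` is not a.e. constant under the PROPOSAL
  law `qν`; `q` may vanish elsewhere, e.g. a Haar class density), `acc` is STRICTLY DECREASING on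
  `[0, ∞)`; **`tiltIMH_meanAccept_strictMonoOn`** (`(−∞, 0]`); positive-density forms `…_of_pos`.
  Proof: the first step of `acc(β′) ≤ E_{p_{β′}}Φ_β(T) ≤ acc(β)` is strict on `{c ≤ T, q > 0}`.
* §2 WILSON theory with product-Haar proposals (the cell's identity flow), every compact `G`,
  continuous `ρ`, `d`, `L` with `S ≢ 0`: `exists_level_neg_wilsonAction` (the level `c = −S(U₀)/2`
  separates the trivial configuration from `U₀`; both sides are non-empty OPEN sets, charged by
  product Haar), **`wilsonIdentityFlow_meanAccept_strictAntiOn_haar`** (STRICTLY decreasing on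
  `[0, ∞)`), **`wilsonIdentityFlow_meanAccept_strictMonoOn_haar`** (strictly increasing on `(−∞, 0]`).
  `S ≢ 0` holds as soon as `L ≥ 2` and `ρ` has a non-maximal trace value
  (`Scaling/IdentityFlowCouplingStrict.…_of_trace`, not imported here).
* §3 the FACTORISED 2-d U(1) model, every NON-EMPTY finite plaquette set: `measure_pi_Ioo_box_pos`,
  `u1_sum_cos_level` (the boxes `(3π/4, 5π/4)^V ⊆ {Σcos < 0}` and `(π/8, 3π/8)^V ⊆ {0 < Σcos}`),
  **`u1IdentityFlow_meanAccept_strictAntiOn`**, **`u1IdentityFlow_meanAccept_strictMonoOn`** —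
  `acc_V` is strictly unimodal in `β` with peak `1` at `β = 0`.

Reading (value-free): for two zero-training LEADERBOARD rows of one Wilson theory at `β < β′` (same
`L`) the ESTIMAND is strictly smaller at `β′`; a printed reversal beyond the error bars points at the
scorer or the bookkeeping.  NOT CLAIMED: a rate; trained flows; any value at the cell's `(β, L)`.
-/

noncomputable section

namespace Summit.Ventures.LatticeQCDFlow.Theory2

open MeasureTheory Real Set

/-! ## §1 General tilt families (proposal density `q ≥ 0`, levels charged where `q > 0`) -/

section Tilt

variable {Ω : Type*} [MeasurableSpace Ω] {ν : Measure Ω} {q T : Ω → ℝ}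

/-- The overlap kernel is STRICTLY decreasing in `β ≥ 0` below the diagonal: for `s < 0` and
`0 ≤ β < β′`, `min(1, e^{β′s}) < min(1, e^{βs})`. [folklore] -/
theorem min_one_exp_mul_lt_of_neg {β β' s : ℝ} (hβ : 0 ≤ β) (hββ' : β < β') (hs : s < 0) :
    min 1 (Real.exp (β' * s)) < min 1 (Real.exp (β * s)) := by
  have h1 : Real.exp (β * s) ≤ 1 := Real.exp_le_one_iff.2 (mul_nonpos_of_nonneg_of_nonpos hβ hs.le)
  have h2 : Real.exp (β' * s) < Real.exp (β * s) := Real.exp_lt_exp.2 (mul_lt_mul_of_neg_right hββ' hs)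
  rw [min_eq_right h1, min_eq_right (h2.le.trans h1)]
  exact h2

variable (hq : ∀ x, 0 ≤ q x) (hqm : Measurable q) (hTm : Measurable T)
  (hint : ∀ γ : ℝ, 0 ≤ γ → Integrable (fun x => q x * Real.exp (γ * T x)) ν)
include hq hqm hTm hint

/-- **Strict kernel gap**: if `ν{T < c, q > 0} > 0` then `Φ_{β′}(t) < Φ_β(t)` for every `t ≥ c` and
`0 ≤ β < β′` (`Φ_β(t) = ∫ q·min(1, e^{β(T − t)}) dν`). [ours] -/
theorem integral_mul_min_one_exp_lt {β β' c t : ℝ} (hβ : 0 ≤ β) (hββ' : β < β')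
    (hc : 0 < ν {y | T y < c ∧ 0 < q y}) (hct : c ≤ t) :
    ∫ y, q y * min 1 (Real.exp (β' * (T y - t))) ∂ν
      < ∫ y, q y * min 1 (Real.exp (β * (T y - t))) ∂ν := by
  have hq' : ∀ x, 0 ≤ q x := hq
  have hqi : Integrable q ν := by simpa using hint 0 le_rfl
  have hi := integrable_mul_min_one_exp hq' hqm hTm hqi β t
  have hi' := integrable_mul_min_one_exp hq' hqm hTm hqi β' t
  rw [← sub_pos, ← integral_sub hi hi']
  have hnn : 0 ≤ fun y => q y * min 1 (Real.exp (β * (T y - t)))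
      - q y * min 1 (Real.exp (β' * (T y - t))) := fun y => by
    simp only [Pi.zero_apply, ← mul_sub]
    exact mul_nonneg (hq' y) (sub_nonneg.2 (min_one_exp_mul_antitone_param hβ hββ'.le _))
  rw [integral_pos_iff_support_of_nonneg hnn (hi.sub hi')]
  refine hc.trans_le (measure_mono fun y hy => ?_)
  rw [Function.mem_support, ← mul_sub]
  have hy' : T y < c ∧ 0 < q y := hy
  have hs : T y - t < 0 := by linarith [hy'.1]
  exact (mul_pos hy'.2 (sub_pos.2 (min_one_exp_mul_lt_of_neg hβ hββ' hs))).ne'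

/-- **THE ACCEPTANCE IS STRICTLY DECREASING IN THE COUPLING** whenever the tilt statistic is not
a.e. constant under the proposal law, in the form: some level `c` has `ν{T < c, q > 0} > 0` and
`ν{c ≤ T, q > 0} > 0` (the proposal density `q ≥ 0` may vanish elsewhere).  For `0 ≤ β < β′`:
`acc(β′) < acc(β)`, where `acc(β) = (∫∫ q(x)q(y)·min(e^{βT x}, e^{βT y}) dν dν)/∫ q e^{βT} dν`
(`Scaling/TiltAcceptanceCouplingMonotone`).  Proof: the first step `E_{p_{β′}}Φ_{β′}(T) ≤
E_{p_{β′}}Φ_β(T)` of the monotone proof is strict on `{c ≤ T, q > 0}`. [ours] -/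
theorem tiltIMH_meanAccept_strictAntiOn
    (hT : ∃ c : ℝ, 0 < ν {x | T x < c ∧ 0 < q x} ∧ 0 < ν {x | c ≤ T x ∧ 0 < q x}) :
    StrictAntiOn (fun β : ℝ =>
      (∫ x, ∫ y, q x * q y * min (Real.exp (β * T x)) (Real.exp (β * T y)) ∂ν ∂ν)
        / ∫ x, q x * Real.exp (β * T x) ∂ν) (Ici 0) := by
  obtain ⟨c, hc1, hc2⟩ := hT
  have hq' : ∀ x, 0 ≤ q x := hq
  have hqi : Integrable q ν := by simpa using hint 0 le_rfl
  intro β hβ β' hβ' hββ'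
  have hβ0 : (0 : ℝ) ≤ β := hβ
  have hβ'0 : (0 : ℝ) ≤ β' := hβ'
  set Φ : ℝ → ℝ → ℝ := fun γ t => ∫ y, q y * min 1 (Real.exp (γ * (T y - t))) ∂ν with hΦ
  set M : ℝ → ℝ := fun γ => ∫ x, q x * Real.exp (γ * T x) ∂ν with hM
  -- `q` is charged, so every `M γ > 0`
  have hMpos : ∀ γ, 0 ≤ γ → 0 < M γ := fun γ hγ => by
    rw [hM]
    simp only
    rw [integral_pos_iff_support_of_nonneg (fun x => mul_nonneg (hq x) (Real.exp_pos _).le)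
      (hint γ hγ)]
    refine hc1.trans_le (measure_mono fun x hx => ?_)
    have hx' : T x < c ∧ 0 < q x := hx
    exact (mul_pos hx'.2 (Real.exp_pos _)).ne'
  have hN : ∀ γ, (∫ x, ∫ y, q x * q y * min (Real.exp (γ * T x)) (Real.exp (γ * T y)) ∂ν ∂ν)
      = ∫ x, q x * Real.exp (γ * T x) * Φ γ (T x) ∂ν := fun γ =>
    integral_congr_ae (ae_of_all _ fun x => integral_mul_mul_min_exp_eq γ x)
  show (∫ x, ∫ y, q x * q y * min (Real.exp (β' * T x)) (Real.exp (β' * T y)) ∂ν ∂ν) / M β'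
    < (∫ x, ∫ y, q x * q y * min (Real.exp (β * T x)) (Real.exp (β * T y)) ∂ν ∂ν) / M β
  rw [hN, hN, div_lt_div_iff₀ (hMpos β' hβ'0) (hMpos β hβ0)]
  -- Step 1, STRICT: the kernel gap is positive on `{c ≤ T}`, a set of positive measure
  have hI' := integrable_mul_exp_mul_overlap hq' hqm hTm hqi hβ'0 (hint β' hβ'0)
  have hI := integrable_mul_exp_mul_overlap hq' hqm hTm hqi hβ0 (hint β' hβ'0)
  have step1 : ∫ x, q x * Real.exp (β' * T x) * Φ β' (T x) ∂ν
      < ∫ x, q x * Real.exp (β' * T x) * Φ β (T x) ∂ν := by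
    rw [← sub_pos, ← integral_sub hI hI']
    have hnn : 0 ≤ fun x => q x * Real.exp (β' * T x) * Φ β (T x)
        - q x * Real.exp (β' * T x) * Φ β' (T x) := fun x => by
      simp only [Pi.zero_apply, ← mul_sub]
      exact mul_nonneg (mul_nonneg (hq' x) (Real.exp_pos _).le)
        (sub_nonneg.2 (integral_mul_min_one_exp_antitone_param hq' hqm hTm hqi hβ0 hββ'.le _))
    rw [integral_pos_iff_support_of_nonneg hnn (hI.sub hI')]
    refine hc2.trans_le (measure_mono fun x hx => ?_)
    rw [Function.mem_support, ← mul_sub]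
    have hx' : c ≤ T x ∧ 0 < q x := hx
    exact (mul_pos (mul_pos hx'.2 (Real.exp_pos _))
      (sub_pos.2 (integral_mul_min_one_exp_lt hq hqm hTm hint hβ0 hββ' hc1 hx'.1))).ne'
  -- Step 2: the Chebyshev step (non-strict)
  have cheb := integral_mul_exp_mul_overlap_mul_le hq' hqm hTm hqi hβ0 hββ'.le (hint β hβ0)
    (hint β' hβ'0)
  calc (∫ x, q x * Real.exp (β' * T x) * Φ β' (T x) ∂ν) * M β
      < (∫ x, q x * Real.exp (β' * T x) * Φ β (T x) ∂ν) * M β :=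
        mul_lt_mul_of_pos_right step1 (hMpos β hβ0)
    _ ≤ M β' * ∫ x, q x * Real.exp (β * T x) * Φ β (T x) ∂ν := cheb
    _ = (∫ x, q x * Real.exp (β * T x) * Φ β (T x) ∂ν) * M β' := mul_comm _ _

omit hint in
/-- **… and STRICTLY INCREASING on `(−∞, 0]`** (the theorem for `−T`, exponential moments for
`γ ≤ 0`; the two-sided level hypothesis is symmetric). [ours] -/
theorem tiltIMH_meanAccept_strictMonoOn
    (hint : ∀ γ : ℝ, γ ≤ 0 → Integrable (fun x => q x * Real.exp (γ * T x)) ν)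
    (hT : ∃ c : ℝ, 0 < ν {x | T x ≤ c ∧ 0 < q x} ∧ 0 < ν {x | c < T x ∧ 0 < q x}) :
    StrictMonoOn (fun β : ℝ =>
      (∫ x, ∫ y, q x * q y * min (Real.exp (β * T x)) (Real.exp (β * T y)) ∂ν ∂ν)
        / ∫ x, q x * Real.exp (β * T x) ∂ν) (Iic 0) := by
  intro β hβ β' hβ' hββ'
  obtain ⟨c, hc1, hc2⟩ := hT
  have hint' : ∀ γ : ℝ, 0 ≤ γ → Integrable (fun x => q x * Real.exp (γ * -T x)) ν :=
    fun γ hγ => by simpa only [mul_neg, neg_mul] using hint (-γ) (neg_nonpos.2 hγ)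
  have hT' : ∃ c' : ℝ, 0 < ν {x | -T x < c' ∧ 0 < q x} ∧ 0 < ν {x | c' ≤ -T x ∧ 0 < q x} := by
    refine ⟨-c, ?_, ?_⟩
    · have e : {x | -T x < -c ∧ 0 < q x} = {x | c < T x ∧ 0 < q x} := by
        ext x; simp only [mem_setOf_eq, neg_lt_neg_iff]
      rwa [e]
    · have e : {x | -c ≤ -T x ∧ 0 < q x} = {x | T x ≤ c ∧ 0 < q x} := by
        ext x; simp only [mem_setOf_eq, neg_le_neg_iff]
      rwa [e]
  have h := tiltIMH_meanAccept_strictAntiOn (T := fun x => -T x) hq hqm hTm.neg hint' hT'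
    (mem_Ici.2 (neg_nonneg.2 (mem_Iic.1 hβ'))) (mem_Ici.2 (neg_nonneg.2 (mem_Iic.1 hβ)))
    (neg_lt_neg hββ')
  simpa only [neg_mul_neg] using h

omit hq in
/-- **Positive proposal density**: with `q > 0` everywhere the level hypothesis is just
`ν{T < c} > 0`, `ν{c ≤ T} > 0`. [ours] -/
theorem tiltIMH_meanAccept_strictAntiOn_of_pos (hq : ∀ x, 0 < q x)
    (hT : ∃ c : ℝ, 0 < ν {x | T x < c} ∧ 0 < ν {x | c ≤ T x}) :
    StrictAntiOn (fun β : ℝ =>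
      (∫ x, ∫ y, q x * q y * min (Real.exp (β * T x)) (Real.exp (β * T y)) ∂ν ∂ν)
        / ∫ x, q x * Real.exp (β * T x) ∂ν) (Ici 0) := by
  obtain ⟨c, hc1, hc2⟩ := hT
  refine tiltIMH_meanAccept_strictAntiOn (fun x => (hq x).le) hqm hTm hint ⟨c, ?_, ?_⟩
  · rwa [show {x | T x < c ∧ 0 < q x} = {x | T x < c} from Set.ext fun x => by simp [hq x]]
  · rwa [show {x | c ≤ T x ∧ 0 < q x} = {x | c ≤ T x} from Set.ext fun x => by simp [hq x]]

omit hq hint in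
/-- Positive proposal density, `(−∞, 0]` side. [ours] -/
theorem tiltIMH_meanAccept_strictMonoOn_of_pos (hq : ∀ x, 0 < q x)
    (hint : ∀ γ : ℝ, γ ≤ 0 → Integrable (fun x => q x * Real.exp (γ * T x)) ν)
    (hT : ∃ c : ℝ, 0 < ν {x | T x ≤ c} ∧ 0 < ν {x | c < T x}) :
    StrictMonoOn (fun β : ℝ =>
      (∫ x, ∫ y, q x * q y * min (Real.exp (β * T x)) (Real.exp (β * T y)) ∂ν ∂ν)
        / ∫ x, q x * Real.exp (β * T x) ∂ν) (Iic 0) := by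
  obtain ⟨c, hc1, hc2⟩ := hT
  refine tiltIMH_meanAccept_strictMonoOn (fun x => (hq x).le) hqm hTm hint ⟨c, ?_, ?_⟩
  · rwa [show {x | T x ≤ c ∧ 0 < q x} = {x | T x ≤ c} from Set.ext fun x => by simp [hq x]]
  · rwa [show {x | c < T x ∧ 0 < q x} = {x | c < T x} from Set.ext fun x => by simp [hq x]]

end Tilt

/-! ## §2 Wilson lattice gauge theory with product-Haar proposals (the cell's identity flow) -/

section Wilson

open Literature.MathematicalPhysics.QuantumFieldTheory

variable {d L N : ℕ} [NeZero L] {G : Type*} [Group G] [TopologicalSpace G] [IsTopologicalGroup G]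
  [CompactSpace G] [MeasurableSpace G] [BorelSpace G] (ρ : G →* Matrix (Fin N) (Fin N) ℂ)

/-- **Two-sided level of the action under product Haar**: if the Wilson action is not identically
zero, some level `c` has `Haar^{⊗E}{−S < c} > 0` and `Haar^{⊗E}{c ≤ −S} > 0` (the action is
continuous, vanishes at the trivial configuration, and product Haar charges open sets). [ours] -/
theorem exists_level_neg_wilsonAction (hρ : Continuous ρ)
    (hS : ∃ U₀ : GaugeConfig d L G, wilsonAction ρ U₀ ≠ 0) :
    ∃ c : ℝ, 0 < (Measure.pi fun _ : Edge d L => haarProbability G) {U | -wilsonAction ρ U < c} ∧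
      0 < (Measure.pi fun _ : Edge d L => haarProbability G) {U | c ≤ -wilsonAction ρ U} := by
  haveI : (haarProbability G).IsOpenPosMeasure := by unfold haarProbability; infer_instance
  obtain ⟨U₀, hU₀⟩ := hS
  have hcont : Continuous fun U : GaugeConfig d L G => -wilsonAction ρ U :=
    (continuous_wilsonAction_of_continuous ρ hρ).neg
  have h1 : -wilsonAction ρ (1 : GaugeConfig d L G) = 0 := by rw [wilsonAction_one_eq_zero, neg_zero]
  refine ⟨-wilsonAction ρ U₀ / 2, ?_, ?_⟩
  · refine (isOpen_lt hcont continuous_const).measure_pos _ ?_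
    rcases lt_or_gt_of_ne hU₀ with h | h
    · exact ⟨1, by rw [mem_setOf_eq, h1]; linarith⟩
    · exact ⟨U₀, by rw [mem_setOf_eq]; linarith⟩
  · refine lt_of_lt_of_le ((isOpen_lt continuous_const hcont).measure_pos _ ?_)
      (measure_mono fun U (hU : -wilsonAction ρ U₀ / 2 < -wilsonAction ρ U) => le_of_lt hU)
    rcases lt_or_gt_of_ne hU₀ with h | h
    · exact ⟨U₀, by rw [mem_setOf_eq]; linarith⟩
    · exact ⟨1, by rw [mem_setOf_eq, h1]; linarith⟩

/-- **THE UNTRAINED WILSON SAMPLER'S ACCEPTANCE IS STRICTLY DECREASING IN `β ≥ 0`** for every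
compact gauge group `G`, continuous representation `ρ`, dimension `d` and torus size `L` whose Wilson
action is not identically zero (`L ≥ 2`, two directions and a non-maximal trace value suffice —
`Scaling/IdentityFlowCouplingStrict`): product-Haar proposals against `e^{−βS}Haar^{⊗E}/Z(β)`. [ours] -/
theorem wilsonIdentityFlow_meanAccept_strictAntiOn_haar (hρ : Continuous ρ)
    (hS : ∃ U₀ : GaugeConfig d L G, wilsonAction ρ U₀ ≠ 0) :
    StrictAntiOn (fun β : ℝ => ∫ U, ∫ U',
        min (Real.exp (-β * wilsonAction ρ U) / (partitionFunction (d := d) (L := L) ρ β).toReal)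
          (Real.exp (-β * wilsonAction ρ U') / (partitionFunction (d := d) (L := L) ρ β).toReal)
        ∂(Measure.pi fun _ : Edge d L => haarProbability G)
        ∂(Measure.pi fun _ : Edge d L => haarProbability G)) (Ici 0) := by
  have hint : ∀ γ : ℝ, Integrable (fun U : GaugeConfig d L G =>
      (1 : ℝ) * Real.exp (γ * -wilsonAction ρ U)) (Measure.pi fun _ : Edge d L => haarProbability G) :=
    fun γ => by
      simpa only [one_mul, mul_neg, neg_mul] using integrable_exp_mul_wilsonAction ρ hρ (-γ)
        (Measure.pi fun _ : Edge d L => haarProbability G)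
  have h := tiltIMH_meanAccept_strictAntiOn_of_pos (ν := (Measure.pi fun _ : Edge d L => haarProbability G))
    (q := fun _ => (1 : ℝ)) (T := fun U => -wilsonAction ρ U) measurable_const
    (WilsonRP.measurable_wilsonAction ρ hρ).neg (fun γ _ => hint γ) (fun _ => one_pos)
    (exists_level_neg_wilsonAction ρ hρ hS)
  intro β hβ β' hβ' hββ'
  simp only [partitionFunction_toReal_eq_integral ρ hρ,
    wilsonIdentityFlow_meanAccept_eq_ratio ρ (Measure.pi fun _ : Edge d L => haarProbability G) hρ]
  exact h hβ hβ' hββ'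

/-- **… and STRICTLY INCREASING on `(−∞, 0]`.** [ours] -/
theorem wilsonIdentityFlow_meanAccept_strictMonoOn_haar (hρ : Continuous ρ)
    (hS : ∃ U₀ : GaugeConfig d L G, wilsonAction ρ U₀ ≠ 0) :
    StrictMonoOn (fun β : ℝ => ∫ U, ∫ U',
        min (Real.exp (-β * wilsonAction ρ U) / (partitionFunction (d := d) (L := L) ρ β).toReal)
          (Real.exp (-β * wilsonAction ρ U') / (partitionFunction (d := d) (L := L) ρ β).toReal)
        ∂(Measure.pi fun _ : Edge d L => haarProbability G)
        ∂(Measure.pi fun _ : Edge d L => haarProbability G)) (Iic 0) := by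
  have hint : ∀ γ : ℝ, Integrable (fun U : GaugeConfig d L G =>
      (1 : ℝ) * Real.exp (γ * -wilsonAction ρ U)) (Measure.pi fun _ : Edge d L => haarProbability G) :=
    fun γ => by
      simpa only [one_mul, mul_neg, neg_mul] using integrable_exp_mul_wilsonAction ρ hρ (-γ)
        (Measure.pi fun _ : Edge d L => haarProbability G)
  -- the two-sided level for `T = −S` in the `≤ / <` form
  have hT : ∃ c : ℝ, 0 < (Measure.pi fun _ : Edge d L => haarProbability G) {U | -wilsonAction ρ U ≤ c} ∧
      0 < (Measure.pi fun _ : Edge d L => haarProbability G) {U | c < -wilsonAction ρ U} := by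
    haveI : (haarProbability G).IsOpenPosMeasure := by unfold haarProbability; infer_instance
    obtain ⟨U₀, hU₀⟩ := hS
    have hcont : Continuous fun U : GaugeConfig d L G => -wilsonAction ρ U :=
      (continuous_wilsonAction_of_continuous ρ hρ).neg
    have h1 : -wilsonAction ρ (1 : GaugeConfig d L G) = 0 := by
      rw [wilsonAction_one_eq_zero, neg_zero]
    refine ⟨-wilsonAction ρ U₀ / 2, ?_, ?_⟩
    · refine lt_of_lt_of_le ((isOpen_lt hcont continuous_const).measure_pos _ ?_)
        (measure_mono fun U (hU : -wilsonAction ρ U < -wilsonAction ρ U₀ / 2) => le_of_lt hU)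
      rcases lt_or_gt_of_ne hU₀ with h | h
      · exact ⟨1, by rw [mem_setOf_eq, h1]; linarith⟩
      · exact ⟨U₀, by rw [mem_setOf_eq]; linarith⟩
    · refine (isOpen_lt continuous_const hcont).measure_pos _ ?_
      rcases lt_or_gt_of_ne hU₀ with h | h
      · exact ⟨U₀, by rw [mem_setOf_eq]; linarith⟩
      · exact ⟨1, by rw [mem_setOf_eq, h1]; linarith⟩
  have h := tiltIMH_meanAccept_strictMonoOn_of_pos (ν := (Measure.pi fun _ : Edge d L => haarProbability G))
    (q := fun _ => (1 : ℝ)) (T := fun U => -wilsonAction ρ U) measurable_const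
    (WilsonRP.measurable_wilsonAction ρ hρ).neg (fun _ => one_pos) (fun γ _ => hint γ) hT
  intro β hβ β' hβ' hββ'
  simp only [partitionFunction_toReal_eq_integral ρ hρ,
    wilsonIdentityFlow_meanAccept_eq_ratio ρ (Measure.pi fun _ : Edge d L => haarProbability G) hρ]
  exact h hβ hβ' hββ'

end Wilson

/-! ## §3 The factorised 2-d U(1) model: strict in `|β|` for every non-empty plaquette set -/

section U1

open Finset
open Summit.Ventures.LatticeQCDFlow.Scoring (onePlaquetteZ onePlaquetteZ_pos)

variable {ι : Type*} [Fintype ι] [Nonempty ι]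

omit [Nonempty ι] in
/-- A box of positive Lebesgue measure inside `(0, 2π]^V`. [folklore] -/
theorem measure_pi_Ioo_box_pos {a b : ℝ} (ha : 0 ≤ a) (hab : a < b) (hb : b ≤ 2 * π) :
    0 < (Measure.pi fun _ : ι => volume.restrict (Ioc (0 : ℝ) (2 * π)))
      (Set.pi univ fun _ : ι => Ioo a b) := by
  rw [Measure.pi_pi]
  refine pos_iff_ne_zero.2 (prod_ne_zero_iff.2 fun i _ => ?_)
  rw [Measure.restrict_apply measurableSet_Ioo,
    inter_eq_left.2 (Ioo_subset_Ioc_self.trans (Ioc_subset_Ioc ha hb)), Real.volume_Ioo]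
  exact (ENNReal.ofReal_pos.2 (by linarith)).ne'

/-- **Two-sided level of `T = Σᵢ cos θᵢ`** at `c = 0`: the boxes `(3π/4, 5π/4)^V ⊆ {T < 0}` and
`(π/8, 3π/8)^V ⊆ {0 < T}` have positive Lebesgue measure. [ours] -/
theorem u1_sum_cos_level :
    0 < (Measure.pi fun _ : ι => volume.restrict (Ioc (0 : ℝ) (2 * π)))
        {x : ι → ℝ | ∑ i, Real.cos (x i) < 0} ∧
      0 < (Measure.pi fun _ : ι => volume.restrict (Ioc (0 : ℝ) (2 * π)))
        {x : ι → ℝ | 0 < ∑ i, Real.cos (x i)} := by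
  constructor
  · refine lt_of_lt_of_le (measure_pi_Ioo_box_pos (a := 3 * π / 4) (b := 5 * π / 4)
      (by positivity) (by linarith [Real.pi_pos]) (by linarith [Real.pi_pos]))
      (measure_mono fun x hx => ?_)
    have hx' : ∀ i, Real.cos (x i) < 0 := fun i => by
      have h := (mem_univ_pi.1 hx) i
      exact Real.cos_neg_of_pi_div_two_lt_of_lt (by linarith [Real.pi_pos, h.1])
        (by linarith [Real.pi_pos, h.2])
    exact sum_neg (fun i _ => hx' i) univ_nonempty
  · refine lt_of_lt_of_le (measure_pi_Ioo_box_pos (a := π / 8) (b := 3 * π / 8)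
      (by positivity) (by linarith [Real.pi_pos]) (by linarith [Real.pi_pos]))
      (measure_mono fun x hx => ?_)
    have hx' : ∀ i, 0 < Real.cos (x i) := fun i => by
      have h := (mem_univ_pi.1 hx) i
      exact Real.cos_pos_of_mem_Ioo ⟨by linarith [Real.pi_pos, h.1], by linarith [Real.pi_pos, h.2]⟩
    exact sum_pos (fun i _ => hx' i) univ_nonempty

/-- **THE UNTRAINED 2-d U(1) SAMPLER: `acc_V(β)` IS STRICTLY DECREASING ON `[0, ∞)`** for every
non-empty finite plaquette set. [ours] -/
theorem u1IdentityFlow_meanAccept_strictAntiOn :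
    StrictAntiOn (fun β : ℝ => ∫ x, ∫ x',
        min ((∏ i : ι, Real.exp (β * Real.cos (x i)) / onePlaquetteZ β) * ∏ _i : ι, (1 / (2 * π) : ℝ))
          ((∏ i : ι, Real.exp (β * Real.cos (x' i)) / onePlaquetteZ β) * ∏ _i : ι, (1 / (2 * π) : ℝ))
        ∂(Measure.pi fun _ : ι => volume.restrict (Ioc (0 : ℝ) (2 * π)))
        ∂(Measure.pi fun _ : ι => volume.restrict (Ioc (0 : ℝ) (2 * π)))) (Ici 0) := by
  obtain ⟨hTm, hint, -⟩ := u1IdentityFlow_tilt_facts (ι := ι)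
  obtain ⟨hneg, hpos⟩ := u1_sum_cos_level (ι := ι)
  have hT : ∃ c : ℝ, 0 < (Measure.pi fun _ : ι => volume.restrict (Ioc (0 : ℝ) (2 * π)))
      {x : ι → ℝ | ∑ i, Real.cos (x i) < c} ∧
      0 < (Measure.pi fun _ : ι => volume.restrict (Ioc (0 : ℝ) (2 * π)))
      {x : ι → ℝ | c ≤ ∑ i, Real.cos (x i)} :=
    ⟨0, hneg, hpos.trans_le (measure_mono fun x (hx : 0 < ∑ i, Real.cos (x i)) => le_of_lt hx)⟩
  have h := tiltIMH_meanAccept_strictAntiOn_of_pos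
    (ν := Measure.pi fun _ : ι => volume.restrict (Ioc (0 : ℝ) (2 * π)))
    (q := fun _ => ∏ _i : ι, (1 / (2 * π) : ℝ)) (T := fun x => ∑ i, Real.cos (x i))
    measurable_const hTm (fun γ _ => hint γ) (fun _ => prod_pos fun _ _ => by positivity) hT
  intro β hβ β' hβ' hββ'
  simp only [u1IdentityFlow_meanAccept_eq_ratio]
  exact h hβ hβ' hββ'

/-- **… AND STRICTLY INCREASING ON `(−∞, 0]`**: the untrained U(1) sampler's acceptance is a
strictly unimodal function of the coupling with its peak (`= 1`) at `β = 0`. [ours] -/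
theorem u1IdentityFlow_meanAccept_strictMonoOn :
    StrictMonoOn (fun β : ℝ => ∫ x, ∫ x',
        min ((∏ i : ι, Real.exp (β * Real.cos (x i)) / onePlaquetteZ β) * ∏ _i : ι, (1 / (2 * π) : ℝ))
          ((∏ i : ι, Real.exp (β * Real.cos (x' i)) / onePlaquetteZ β) * ∏ _i : ι, (1 / (2 * π) : ℝ))
        ∂(Measure.pi fun _ : ι => volume.restrict (Ioc (0 : ℝ) (2 * π)))
        ∂(Measure.pi fun _ : ι => volume.restrict (Ioc (0 : ℝ) (2 * π)))) (Iic 0) := by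
  obtain ⟨hTm, hint, -⟩ := u1IdentityFlow_tilt_facts (ι := ι)
  obtain ⟨hneg, hpos⟩ := u1_sum_cos_level (ι := ι)
  have hT : ∃ c : ℝ, 0 < (Measure.pi fun _ : ι => volume.restrict (Ioc (0 : ℝ) (2 * π)))
      {x : ι → ℝ | ∑ i, Real.cos (x i) ≤ c} ∧
      0 < (Measure.pi fun _ : ι => volume.restrict (Ioc (0 : ℝ) (2 * π)))
      {x : ι → ℝ | c < ∑ i, Real.cos (x i)} :=
    ⟨0, hneg.trans_le (measure_mono fun x (hx : ∑ i, Real.cos (x i) < 0) => le_of_lt hx), hpos⟩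
  have h := tiltIMH_meanAccept_strictMonoOn_of_pos
    (ν := Measure.pi fun _ : ι => volume.restrict (Ioc (0 : ℝ) (2 * π)))
    (q := fun _ => ∏ _i : ι, (1 / (2 * π) : ℝ)) (T := fun x => ∑ i, Real.cos (x i))
    measurable_const hTm (fun _ => prod_pos fun _ _ => by positivity) (fun γ _ => hint γ) hT
  intro β hβ β' hβ' hββ'
  simp only [u1IdentityFlow_meanAccept_eq_ratio]
  exact h hβ hβ' hββ'

end U1

end Summit.Ventures.LatticeQCDFlow.Theory2
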